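import Summits.ResolutionOfSingularities.ResolutionOfSingularities.Theorems.HilbertSamuelEliminationSigmaMaxModificationsCorridor3WLadderIsoInsepE2NearChart
import Summits.ResolutionOfSingularities.ResolutionOfSingularities.Theorems.HilbertSamuelEliminationSigmaMaxModificationsCorridor3WLadderIsoInsepE2Tower
import Summits.ResolutionOfSingularities.ResolutionOfSingularities.Theorems.HilbertSamuelEliminationSigmaMaxModificationsCorridor3WLadderIsoInsepDoublePointPropagates
import Summits.ResolutionOfSingularities.ResolutionOfSingularities.Theorems.HilbertSamuelEliminationSigmaMaxModificationsCorridor3WLadderIsoTailsFormalFrameAssemblyStep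
import HarnessLib

/-!
# [OURS · L1 W4.2] E2 chart calculus, brick 10: (N2′) ON THE TOWER — «NEAR ⇒ ON THE LINE `V(x̄, ȳ)`»: after an E2 stage of an
# isolated E3 point tower over a maximal origin of characteristic two, the next point lies on the line `V(x̄, ȳ) ≅ ℙ¹` of the
# exceptional `ℙ³` and the strict transform has order exactly two there (crux chain w42, cell k2 `T3insep` = `stub_isoInsepTower`;
# `--supports stmt-ResolutionOfSingularities-19249`)

OURS (cell res-hironaka, slot W4.2, seat res-D-pv-042; OWN OBJECT TUO 18:19Z); NOT a statement of [Hironaka2017] nor of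
[CossartJannsenSaito2020] / [CossartPiltant2008]. AI-drafted, weaker than expert review. PROOF file, def-free, fact-free.

* `strictTransform_order_two_of_isIsoPointTower` — NEARNESS READ ON THE STRICT TRANSFORM: along an isolated E3 point tower over a
  maximal origin (any characteristic `p`... here `2`), if `𝒪_{X_n,x_n} = R/(h)` with `h` of order `2` in a regular local `R` of
  embedding dimension `4` and `𝒪_{X_{n+1},x_{n+1}} = L/(h′)` for a regular local `L` and `h′ ≠ 0`, then `h′ ∈ 𝔪_L² ∖ 𝔪_L³`
  (Hilbert–Samuel constancy along the tower, res-type-001's `IsoTailsHS.hilbertSamuelFun_stalk_eq_of_isIsoPointTower`, + the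
  propagated formal double point, + `IdeasL1C5.FormalFrame.mem_pow_and_not_mem_pow_succ_of_hilbertSamuelFun_eq`).
* `exists_e2StepPresentation_onLine` — brick 7 `exists_e2StepPresentation` with three more clauses: residue characteristic two read in
  `R` (`2 ∈ 𝔪_R`), `h′/1 ∈ 𝔪² ∖ 𝔪³` in `B_𝔔`, and **`c₀/c_j, c₁/c_j ∈ 𝔔`, `j ∉ {0, 1}`** (brick 9): the START DATUM of (N3).
-/

noncomputable section

set_option linter.dupNamespace false

open scoped Classical
open CategoryTheory AlgebraicGeometry TopologicalSpace IsLocalRing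
open Literature.RingTheory.HilbertSamuel Literature.AlgebraicGeometry.Resolution Literature.AlgebraicGeometry.CossartJannsenSaito2020
open Summit.ResolutionOfSingularities.ResolutionOfSingularities.Theorems.CampaignW42
open Summit.ResolutionOfSingularities.ResolutionOfSingularities.Theorems.SigmaMaxModificationsCorridor3
open Summit.ResolutionOfSingularities.ResolutionOfSingularities.Theorems.SigmaMaxModificationsCorridor3.Moving (exists_towerStructure)
open Summit.ResolutionOfSingularities.ResolutionOfSingularities.Cruxes.SigmaMaxModifications.IdeasL1Idea2R4 (IsIsoPointTower)
open Summit.ResolutionOfSingularities.ResolutionOfSingularities.Cruxes.SigmaMaxModifications.IdeasL1C5 (IsInsepStage)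
open Summit.ResolutionOfSingularities.ResolutionOfSingularities.Cruxes.SigmaMaxModifications.IdeasL1C5.FormalFrame
  (mem_pow_and_not_mem_pow_succ_of_hilbertSamuelFun_eq)

namespace Summit.ResolutionOfSingularities.ResolutionOfSingularities.Cruxes.SigmaMaxModifications.IdeasL1C6

/-- **Nearness read on the strict transform.** Along an isolated E3 point tower over a maximal origin of characteristic two, let stage
`n` be a formal double point presented as `σ : R ↠ 𝒪_{X_n,x_n}`, `ker σ = (h)`, `h ∈ 𝔪² ∖ 𝔪³`, `R` regular local of embedding
dimension `4`, and let `σ′ : L ↠ 𝒪_{X_{n+1},x_{n+1}}` be a presentation of the next stalk from a regular local ring `L` with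
`ker σ′ = (h′)`, `h′ ≠ 0`. Then `h′ ∈ 𝔪_L² ∖ 𝔪_L³`: the next point is again a double point OF THE STRICT TRANSFORM (the Hilbert–Samuel
function is constant along the tower and determines embedding dimension and order). [OURS · L1 W4.2 · k2 · brick 10] [folklore] -/
theorem strictTransform_order_two_of_isIsoPointTower {N : ℕ} {ν : ℕ → ℕ} {T : BlowupTower.{0}} {pt : ∀ n, T.X n}
    (hO : IsMaximalOrigin 2 N ν (T.X 0) (pt 0)) (hT : IsIsoPointTower N ν T pt) (n : ℕ)
    (hdp : IsFormalDoublePointAt (T.X n) (pt n))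
    {R : Type} [CommRing R] [IsRegularLocalRing R] (h4 : (maximalIdeal R).spanFinrank = 4)
    (σ : R →+* (T.X n).presheaf.stalk (pt n)) (hσ : Function.Surjective σ) {h : R}
    (hker : RingHom.ker σ = Ideal.span {h}) (hh2 : h ∈ maximalIdeal R ^ 2) (hh3 : h ∉ maximalIdeal R ^ 3)
    {L : Type} [CommRing L] [IsRegularLocalRing L] (σ' : L →+* (T.X (n + 1)).presheaf.stalk (pt (n + 1)))
    (hσ' : Function.Surjective σ') {h' : L} (hker' : RingHom.ker σ' = Ideal.span {h'}) (hh'0 : h' ≠ 0) :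
    h' ∈ maximalIdeal L ^ 2 ∧ h' ∉ maximalIdeal L ^ 3 := by
  haveI : IsLocallyNoetherian (T.X n) := T.ln n
  haveI : IsLocallyNoetherian (T.X (n + 1)) := T.ln (n + 1)
  -- Hilbert–Samuel constancy along the tower
  have hHS : hilbertSamuelFun ((T.X (n + 1)).presheaf.stalk (pt (n + 1))) 0 = hilbertSamuelFun ((T.X n).presheaf.stalk (pt n)) 0 := by
    rw [IsoTailsHS.hilbertSamuelFun_stalk_eq_of_isIsoPointTower hO hT (n + 1) 0,
      IsoTailsHS.hilbertSamuelFun_stalk_eq_of_isIsoPointTower hO hT n 0]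
  -- `dim R = 4`
  have hR : ringKrullDim R = (4 : ℕ) := by
    have := IsRegularLocalRing.spanFinrank_maximalIdeal (R := R)
    rw [h4] at this
    exact_mod_cast this.symm
  -- `dim L = 4`: `L/(h′) ≅ 𝒪_{X_{n+1},x_{n+1}}` has dimension `3` (a formal double point), `h′` a non-zero non-unit of the domain `L`
  haveI := isDomain_of_isRegularLocalRing L
  have hdp' : IsFormalDoublePointAt (T.X (n + 1)) (pt (n + 1)) := isFormalDoublePointAt_succ_of_isIsoPointTower hO hT n hdp
  have h3 : ringKrullDim ((T.X (n + 1)).presheaf.stalk (pt (n + 1))) = (3 : ℕ) :=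
    ringKrullDim_stalk_eq_three_of_isFormalDoublePointAt hdp'
  have hh'𝔪 : h' ∈ maximalIdeal L := by
    rw [IsLocalRing.mem_maximalIdeal, mem_nonunits_iff]
    intro hu
    have h0 : σ' h' = 0 := by rw [← RingHom.mem_ker, hker']; exact Ideal.mem_span_singleton_self h'
    have := hu.map σ'
    rw [h0] at this
    exact not_isUnit_zero this
  have hL : ringKrullDim L = (4 : ℕ) := by
    let e : (L ⧸ Ideal.span {h'}) ≃+* (T.X (n + 1)).presheaf.stalk (pt (n + 1)) :=
      (Ideal.quotEquivOfEq hker').symm.trans (RingHom.quotientKerEquivOfSurjective hσ')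
    have h1 : ringKrullDim (L ⧸ Ideal.span {h'}) = (3 : ℕ) := by rw [ringKrullDim_eq_of_ringEquiv e, h3]
    have h2 := ringKrullDim_quotient_span_singleton_succ_eq_ringKrullDim_of_mem_nonZeroDivisors
      (mem_nonZeroDivisors_of_ne_zero hh'0) hh'𝔪
    rw [h1] at h2
    rw [← h2]
    rfl
  exact mem_pow_and_not_mem_pow_succ_of_hilbertSamuelFun_eq (e := 4) (by norm_num) hR hL σ hσ hker hh2 hh3 σ' hσ'
    hker' hh'0 hHS

/-- **(N2′) ON THE TOWER — «NEAR ⇒ ON THE LINE `V(x̄, ȳ)`».** Along an isolated E3 point tower over a maximal origin of characteristic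
two, at an E2 stage `n`: the E2 step presentation of brick 7 (`exists_e2StepPresentation`: E2-adapted regular parameters `c` of `R`,
`𝒪_{X_n,x_n} = R/(h)`, `h ≡ ĉ(c₀² + λ̂c₁²) (mod 𝔪³)`; a chart `j`, a prime `𝔔` of `B = R[𝔪/c_j]` over `𝔪_R`, the strict transform `h′`,
`𝒪_{X_{n+1},x_{n+1}} ≅ B_𝔔/(h′)`, all clauses kept) TOGETHER WITH: `2 ∈ 𝔪_R`; `h′/1 ∈ 𝔪² ∖ 𝔪³` in `B_𝔔` (the next point is a double point
of the strict transform); and **`c₀/c_j ∈ 𝔔`, `c₁/c_j ∈ 𝔔`, `j ≠ 0`, `j ≠ 1`** — the next point lies on the line `V(x̄, ȳ) ≅ ℙ¹` of the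
exceptional `ℙ³ = ℙ(𝔪/𝔪²)`, in a `z`- or `w`-chart. This is the start datum of (N3) «on the line: near ⟺ `P_τ | g₃`».
[OURS · L1 W4.2 · k2 · E2 chart calculus, brick 10] [folklore] -/
theorem exists_e2StepPresentation_onLine {N : ℕ} {ν : ℕ → ℕ} {T : BlowupTower.{0}} {pt : ∀ n, T.X n}
    (hO : IsMaximalOrigin 2 N ν (T.X 0) (pt 0)) (hT : IsIsoPointTower N ν T pt) (n : ℕ) (hE : IsE2Stage T pt n) :
    ∃ (R : Type) (_ : CommRing R) (_ : IsRegularLocalRing R) (c : Fin 4 → R) (σ : R →+* (T.X n).presheaf.stalk (pt n))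
      (h cc lam : R) (hpt : (T.π n) (pt (n + 1)) = pt n),
      (maximalIdeal R).spanFinrank = 4 ∧ Ideal.span (Set.range c) = maximalIdeal R ∧ Function.Surjective σ ∧
      RingHom.ker σ = Ideal.span {h} ∧ h ∈ maximalIdeal R ^ 2 ∧ h ∉ maximalIdeal R ^ 3 ∧
      cc ∉ maximalIdeal R ∧ (∀ u : R, u ^ 2 - lam ∉ maximalIdeal R) ∧
      h - cc * (c 0 ^ 2 + lam * c 1 ^ 2) ∈ maximalIdeal R ^ 3 ∧ (2 : R) ∈ maximalIdeal R ∧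
    ∃ (j : Fin 4) (𝔔 : PrimeSpectrum (blowupAlgebra (Ideal.span (Set.range c)) (c j)))
      (h' : blowupAlgebra (Ideal.span (Set.range c)) (c j))
      (σ' : Localization.AtPrime 𝔔.asIdeal →+* (T.X (n + 1)).presheaf.stalk (pt (n + 1))),
      algebraMap R _ h = algebraMap R _ (c j) ^ 2 * h' ∧
      Prime (algebraMap R (blowupAlgebra (Ideal.span (Set.range c)) (c j)) (c j)) ∧
      ¬ algebraMap R (blowupAlgebra (Ideal.span (Set.range c)) (c j)) (c j) ∣ h' ∧
      𝔔.asIdeal.comap (algebraMap R _) = maximalIdeal R ∧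
      h' ∈ 𝔔.asIdeal ∧
      IsRegularLocalRing (Localization.AtPrime 𝔔.asIdeal) ∧
      Function.Surjective σ' ∧
      RingHom.ker σ' = Ideal.span {algebraMap _ (Localization.AtPrime 𝔔.asIdeal) h'} ∧
      (∀ r : R, σ' (algebraMap _ (Localization.AtPrime 𝔔.asIdeal)
        (algebraMap R (blowupAlgebra (Ideal.span (Set.range c)) (c j)) r)) =
          ((T.π n).stalkMap (pt (n + 1))).hom (((T.X n).presheaf.stalkCongr (.of_eq hpt)).inv (σ r))) ∧
      (∀ k : Fin 4, σ' (algebraMap _ (Localization.AtPrime 𝔔.asIdeal) (blowupAlgebra.frac c j k)) *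
        ((T.π n).stalkMap (pt (n + 1))).hom (((T.X n).presheaf.stalkCongr (.of_eq hpt)).inv (σ (c j))) =
          ((T.π n).stalkMap (pt (n + 1))).hom (((T.X n).presheaf.stalkCongr (.of_eq hpt)).inv (σ (c k)))) ∧
      ((T.π n).stalkMap (pt (n + 1))).hom (((T.X n).presheaf.stalkCongr (.of_eq hpt)).inv (σ (c j))) ∈
        nonZeroDivisors ((T.X (n + 1)).presheaf.stalk (pt (n + 1))) ∧
      stalkIdeal ((T.centreIdeal n).comap (T.π n)) (pt (n + 1)) =
        Ideal.span {((T.π n).stalkMap (pt (n + 1))).hom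
          (((T.X n).presheaf.stalkCongr (.of_eq hpt)).inv (σ (c j)))} ∧
      algebraMap _ (Localization.AtPrime 𝔔.asIdeal) h' ∈ maximalIdeal (Localization.AtPrime 𝔔.asIdeal) ^ 2 ∧
      algebraMap _ (Localization.AtPrime 𝔔.asIdeal) h' ∉ maximalIdeal (Localization.AtPrime 𝔔.asIdeal) ^ 3 ∧
      blowupAlgebra.frac c j 0 ∈ 𝔔.asIdeal ∧ blowupAlgebra.frac c j 1 ∈ 𝔔.asIdeal ∧ j ≠ 0 ∧ j ≠ 1 := by
  obtain ⟨R, _, _, c, σ, h, cc, lam, hpt, h4, hc, hσ, hker, hh2, hh3, hcc, hlam, hshape, j, 𝔔, h', σ', hh', hprime, hndvd,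
    h𝔔, hh'𝔔, hreg, hσ', hker', hrest⟩ := exists_e2StepPresentation hO hT n hE
  haveI := hreg
  haveI : IsLocallyNoetherian (T.X n) := T.ln n
  -- residue characteristic two read in `R`: `σ(2) = 2 = 0` in the `k`-algebra `𝒪_{X_n,x_n}`
  have h2 : (2 : R) ∈ maximalIdeal R := by
    obtain ⟨k, _, _, f₀, hsep, hft, hqc⟩ := hO.exists_structure
    haveI := hsep
    haveI := hft
    haveI := hqc
    obtain ⟨f, -, -, -⟩ := exists_towerStructure T f₀
    obtain ⟨φ⟩ := exists_ringHom_field_stalk (f n) (pt n)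
    have hk2 : (2 : k) = 0 := by
      have := CharP.cast_eq_zero k 2
      simpa using this
    have hst : (2 : (T.X n).presheaf.stalk (pt n)) = 0 := by rw [← map_ofNat φ 2, hk2, map_zero]
    have hker2 : (2 : R) ∈ RingHom.ker σ := by rw [RingHom.mem_ker, map_ofNat, hst]
    rw [hker] at hker2
    exact (Ideal.span_singleton_le_iff_mem _).mpr (Ideal.pow_le_self two_ne_zero hh2) hker2
  -- `h′/1 ≠ 0`: `B = R[𝔪/c_j]` is a domain and `c_j ∤ h′`
  haveI := isDomain_of_isRegularLocalRing R
  have hcj0 : c j ≠ 0 := by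
    intro h0
    rw [h0, map_zero] at hprime
    exact not_prime_zero hprime
  haveI : IsDomain (Localization.Away (c j)) :=
    IsLocalization.isDomain_localization (powers_le_nonZeroDivisors_of_noZeroDivisors hcj0)
  haveI : IsDomain (blowupAlgebra (Ideal.span (Set.range c)) (c j)) := inferInstance
  have hh'ne : h' ≠ 0 := by
    rintro rfl
    exact hndvd (dvd_zero _)
  have hh'0 : algebraMap _ (Localization.AtPrime 𝔔.asIdeal) h' ≠ 0 := fun h0 =>
    hh'ne (IsLocalization.injective (Localization.AtPrime 𝔔.asIdeal) 𝔔.asIdeal.primeCompl_le_nonZeroDivisors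
      (by rw [h0, map_zero]))
  -- order two on the strict transform
  obtain ⟨hh'2, hh'3⟩ := strictTransform_order_two_of_isIsoPointTower hO hT n hE.2.1 h4 σ hσ hker hh2 hh3
    (L := Localization.AtPrime 𝔔.asIdeal) σ' hσ' hker' hh'0
  -- on the line (brick 9)
  obtain ⟨hfr0, hfr1⟩ := E2Chart.frac_mem_and_frac_mem_of_strictTransform_mem_sq h4 c hc h2 (i₀ := 0) (i₁ := 1) (by decide)
    hcc hlam hshape j 𝔔.asIdeal h𝔔 hh' hh'2
  have hne_top : 𝔔.asIdeal ≠ ⊤ := 𝔔.isPrime.ne_top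
  have hj0 : j ≠ 0 := by
    rintro rfl
    apply hne_top
    rw [Ideal.eq_top_iff_one]
    have : blowupAlgebra.frac c 0 0 = 1 := blowupAlgebra.gen_self _ _ _
    rwa [this] at hfr0
  have hj1 : j ≠ 1 := by
    rintro rfl
    apply hne_top
    rw [Ideal.eq_top_iff_one]
    have : blowupAlgebra.frac c 1 1 = 1 := blowupAlgebra.gen_self _ _ _
    rwa [this] at hfr1
  exact ⟨R, inferInstance, inferInstance, c, σ, h, cc, lam, hpt, h4, hc, hσ, hker, hh2, hh3, hcc, hlam, hshape, h2, j, 𝔔, h', σ',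
    hh', hprime, hndvd, h𝔔, hh'𝔔, hreg, hσ', hker', hrest.1, hrest.2.1, hrest.2.2.1, hrest.2.2.2, hh'2, hh'3, hfr0, hfr1, hj0, hj1⟩

end Summit.ResolutionOfSingularities.ResolutionOfSingularities.Cruxes.SigmaMaxModifications.IdeasL1C6

end
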